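import Summits.ResolutionOfSingularities.ResolutionOfSingularities.Theorems.EquisingularLiftEquisingularLiftNatDeterminantalLiftDownstairs
import Summits.ResolutionOfSingularities.ResolutionOfSingularities.Theorems.EquisingularLiftEquisingularLiftNatHilbertBurchHomogeneous
import Summits.ResolutionOfSingularities.ResolutionOfSingularities.Theorems.EquisingularLiftEquisingularLiftNatCompleteIntersectionLift
import HarnessLib

/-!
# [OURS · L1 W4.5(b) · EL♮(3)] T-DET-PROJ, part 4 (CAPSTONE): the (LIFT)-form supplier for the SMOOTH DETERMINANTAL NOSE — every smooth
# `Σ = V₊(I_t(M)) ⊂ ℙⁿ_k` (maximal minors of a `(t+1) × t` matrix of forms, Jacobian-pair clause) has an `O`-SMOOTH lift `C ⊂ ℙⁿ_O` with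
# `C · 𝒪_{ℙⁿ_k} = 𝓘_Σ`, over every complete DVR `O ↠ k`

Cell `res-hironaka`, rung L, slot W4.5(b); crux **EL♮(3)** (stmt-ResolutionOfSingularities-20148), rung v6′ «DET-nose» (res-L1-w45b-lead-2
LEAD-MEMO-5 §B; TAKING res-type-097 2026-08-27T09:48:24Z; plan AGREED 09:57:46Z). OURS; NOT a statement of any manuscript; AI-written, weaker
than expert review. No definition, no `sorry`, standard axioms. `--supports stmt-ResolutionOfSingularities-20148 --as helper`; closes nothing by
itself — it is the (LIFT) input of the v6′ registered stub TARGET-DETNOSE (lead-2's pen), exactly parallel to res-D-pv-027's `CILift.ciLift` for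
`stub_elnat_ciNoseThenPoints_of_suppliers`. Parts 1–3: `…NatDeterminantalLiftAlgebra` (p521649), `…NatDeterminantalLiftNose` (p523002),
`…NatDeterminantalLiftDownstairs`.

* `smooth_detNose_of_flat` — T4 for the determinantal nose: `O` a DVR, `π : O ↠ k` onto a PERFECT field, `M = π M̃`; under (J′-pair)
  downstairs and FLATNESS of `V(I_t(M̃)~) → Spec O` (part 2), `V(I_t(M̃)~) → Spec O` is SMOOTH — res-type-027's `EmbeddedLift.LiftsEmbedded.smooth`
  (Stacks 01V8 spread over the local base) with the smooth special fibre `V(I_t(M)~)` of part 3 (route of res-type-051's T4, cited).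
* `comap_projIdealSheaf_rowMinors_eq_vanishingIdeal` — hKEY: `I_t(M̃)~ · 𝒪_{ℙⁿ_k} = 𝓘_Σ` (base change p518108 + part 3).
* DEGREE BOOKKEEPING AND THE LIFT are res-type-032's HB part 5 `…NatHilbertBurchHomogeneous` (p523558), consumed BY NAME: entries of degrees
  `α_a + β_b` ⇒ row-deleted maximal minors are forms of degree `Σ_i α_{l.succAbove i} + Σ_j β_j` (`det_submatrix_succAbove_mem_homogeneousSubmodule`),
  and an entrywise homogeneous lift `M̃` along `π` exists (`exists_homogeneous_lift_rowMinors`).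
* (`π ϖ = 0` is res-D-pv-027's `CILift.map_eq_zero_of_irreducible`, p522728.)
* **`detLift`** — THE (LIFT)-FORM SUPPLIER: `∀ (k) [Field k] [IsAlgClosed k] (n : ℕ)`, for every complete DVR `O` with `π : O ↠ k`, every `t`,
  degrees `α, β`, matrix `M` of forms `M_{ab} ∈ 𝒜_k(α_a + β_b)` whose determinantal locus `Σ = {y | ∀ l, det(M minus row l) ∈ 𝔮_y}` satisfies
  the JACOBIAN-PAIR clause «∀ y ∈ Σ ∃ a b (e : Fin 2 ↪ Fin (n+1)), det (∂(Δ_a,Δ_b)/∂(x_{e0},x_{e1})) ∉ 𝔮_y», and every closedness proof `hSig`: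
  **`∃ C` on `ℙⁿ_O` with `Smooth (C.subschemeι ≫ ℙⁿ_O → Spec O)` and `C.comap (Proj.map φ hφ') = vanishingIdeal ⟨Σ, hSig⟩` for every graded
  `φ` over `π`** — `C := I_t(M̃)~` for an entrywise homogeneous lift `M̃`. Ingredients by name: part 2 `isRegular_and_flat_detNose` (Eagon–
  Northcott UPSTAIRS ⇒ regular + flat), part 3 `pairDown_of_jacobianPair` (res-type-051's CI-JAC, c = 2) / `smooth_subschemeι_…` /
  `projIdealSheaf_rowMinors_eq_vanishingIdeal` (Eagon–Northcott DOWNSTAIRS), res-D-pv-027's base change. No Hilbert–Burch complex anywhere.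
  TODO(general form): Hilbert–Burch degree matrices `deg M_{ab} = u_b − v_a` with some NEGATIVE virtual degrees (forced zero entries) are not all
  of the shape `α_a + β_b` with `α, β ≥ 0`; such `Σ` are covered after permuting/clearing only when an additive non-negative bookkeeping exists.

References: H. Matsumura, *Commutative Ring Theory* (1986), Thm. 13.10, Thms. 14.2–14.3, Thm. 30.4 [Matsumura1987]; R. Hartshorne, *Algebraic
Geometry* (1977), II Prop. 5.9, III Prop. 9.7 [Hartshorne1977]; Stacks 01V8, 00TV [StacksProject]; cell: LEAD-MEMO-5 §B, CiNoseThenPointsOfSuppliers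
(lead-2), res-D-pv-027 `CILift.ciLift` (pattern, OURS).
-/

set_option linter.dupNamespace false -- mandated namespace `Summit.<Summit>.<Problem>` of this single-conjunct summit
set_option linter.overlappingInstances false -- signatures carry `[IsDomain O] [IsDiscreteValuationRing O]`

noncomputable section

open CategoryTheory AlgebraicGeometry TopologicalSpace IsLocalRing Opposite
open MvPolynomial HomogeneousLocalization
open Literature.AlgebraicGeometry.Resolution
open Literature.RingTheory.KrullDimension
open Summit.ResolutionOfSingularities.ResolutionOfSingularities.Cruxes.EquisingularLift.StrataSplit

attribute [local instance] MvPolynomial.gradedAlgebra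

namespace Summit.ResolutionOfSingularities.ResolutionOfSingularities.Cruxes.EquisingularLiftNat.Sections

namespace DetLift

/-! ## §0 `π` of a lifted minor -/

section MapMinor

variable {O k : Type} [CommRing O] [CommRing k] (π : O →+* k) {σ : Type} {t : ℕ}
  (Mt : Matrix (Fin (t + 1)) (Fin t) (MvPolynomial σ O)) (M : Matrix (Fin (t + 1)) (Fin t) (MvPolynomial σ k))
  (hMtM : ∀ a b, MvPolynomial.map π (Mt a b) = M a b)
  (Δt : Fin (t + 1) → MvPolynomial σ O) (Δ : Fin (t + 1) → MvPolynomial σ k)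
  (hΔtdef : ∀ l, Δt l = (Mt.submatrix l.succAbove id).det) (hΔdef : ∀ l, Δ l = (M.submatrix l.succAbove id).det)

include hMtM hΔtdef hΔdef in
/-- `π` of a lifted maximal minor is the maximal minor (`det` commutes with ring homomorphisms). [folklore] -/
theorem map_rowMinor_eq : ∀ l, MvPolynomial.map π (Δt l) = Δ l := by
  intro l
  rw [hΔtdef, hΔdef, RingHom.map_det, RingHom.mapMatrix_apply, ← Matrix.submatrix_map]
  congr 1
  exact Matrix.ext fun a b => hMtM _ _

end MapMinor

/-! ## §1 T4 and hKEY for the determinantal nose -/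

section Upstairs

variable {O : Type} [CommRing O] [IsDomain O] [IsDiscreteValuationRing O] {k : Type} [Field k]
  (π : O →+* k) (hπ : Function.Surjective π) {n t : ℕ}
  (φ : (homogeneousSubmodule (Fin (n + 1)) O) →+*ᵍ (homogeneousSubmodule (Fin (n + 1)) k))
  (hφ' : HomogeneousIdeal.irrelevant (homogeneousSubmodule (Fin (n + 1)) k) ≤
    (HomogeneousIdeal.irrelevant (homogeneousSubmodule (Fin (n + 1)) O)).map φ)
  (hφ : ∀ s, φ s = MvPolynomial.map π s)
  (Mt : Matrix (Fin (t + 1)) (Fin t) (MvPolynomial (Fin (n + 1)) O))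
  (M : Matrix (Fin (t + 1)) (Fin t) (MvPolynomial (Fin (n + 1)) k))
  (hMtM : ∀ a b, MvPolynomial.map π (Mt a b) = M a b)
  (Δt : Fin (t + 1) → MvPolynomial (Fin (n + 1)) O) (Δ : Fin (t + 1) → MvPolynomial (Fin (n + 1)) k)
  (hΔtdef : ∀ l, Δt l = (Mt.submatrix l.succAbove id).det) (hΔdef : ∀ l, Δ l = (M.submatrix l.succAbove id).det)
  (D : Fin (t + 1) → ℕ)
  (hΔt : ∀ l, Δt l ∈ homogeneousSubmodule (Fin (n + 1)) O (D l))
  (hΔ : ∀ l, Δ l ∈ homogeneousSubmodule (Fin (n + 1)) k (D l))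
  (hJ : ∀ y ∈ (projIdealSheaf (homogeneousSubmodule (Fin (n + 1)) k)
      ⟨Ideal.span (Set.range Δ), isHomogeneous_span_of_forall_mem _ Δ D hΔ⟩).support,
    ∃ (i : Fin (n + 1)) (hyi : y ∈ Proj.basicOpen (homogeneousSubmodule (Fin (n + 1)) k) (X i)) (a b : Fin (t + 1)),
      ∀ c : Fin 2 → (Proj (homogeneousSubmodule (Fin (n + 1)) k)).presheaf.stalk y,
        ∑ l, c l * ((Proj (homogeneousSubmodule (Fin (n + 1)) k)).presheaf.germ
            (Proj.basicOpen (homogeneousSubmodule (Fin (n + 1)) k) (X i)) y hyi).hom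
          ((Proj.awayToSection (homogeneousSubmodule (Fin (n + 1)) k) (X i)).hom
            (mk₁ (homogeneousSubmodule (Fin (n + 1)) k) (CILift.X_mem_one' i) (D (![a, b] l))
              (Δ (![a, b] l)) (hΔ (![a, b] l)))) ∈
          maximalIdeal ((Proj (homogeneousSubmodule (Fin (n + 1)) k)).presheaf.stalk y) ^ 2 →
        ∀ l, c l ∈ maximalIdeal ((Proj (homogeneousSubmodule (Fin (n + 1)) k)).presheaf.stalk y))

include hπ hφ' hφ hMtM hΔtdef hΔdef hJ in
/-- **T4 for the determinantal nose — THE SMOOTH UPGRADE.** `O` a DVR, `π : O ↠ k` onto a PERFECT field, `φ` the coefficient map, `M = π M̃`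
entrywise, minors named by `hΔtdef`/`hΔdef`, forms of degrees `D_l`; under (J′-pair) downstairs, if the nose `V(I_t(M̃)~) → Spec O` is FLAT
(part 2) then it is SMOOTH: an embedded `O`-lift (res-type-027's `LiftsEmbedded`: flat + `I_t(M̃)~ · 𝒪_{ℙⁿ_k} = I_t(M)~`, res-D-pv-027's base
change) of the smooth `k`-scheme `V(I_t(M)~)` (part 3), so `EmbeddedLift.LiftsEmbedded.smooth` applies — route of res-type-051's
`CILift.smooth_ciNose_of_flat` (p521509), cited. [cite: StacksProject, Tag 01V8] -/
theorem smooth_detNose_of_flat [PerfectField k]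
    (hflat : Flat ((projIdealSheaf (homogeneousSubmodule (Fin (n + 1)) O)
        ⟨Ideal.span (Set.range Δt), isHomogeneous_span_of_forall_mem _ Δt D hΔt⟩).subschemeι ≫
      Proj.toSpecZero (homogeneousSubmodule (Fin (n + 1)) O) ≫
        Spec.map (CommRingCat.ofHom (algebraMap O ((homogeneousSubmodule (Fin (n + 1)) O) 0))))) :
    Smooth ((projIdealSheaf (homogeneousSubmodule (Fin (n + 1)) O)
        ⟨Ideal.span (Set.range Δt), isHomogeneous_span_of_forall_mem _ Δt D hΔt⟩).subschemeι ≫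
      Proj.toSpecZero (homogeneousSubmodule (Fin (n + 1)) O) ≫
        Spec.map (CommRingCat.ofHom (algebraMap O ((homogeneousSubmodule (Fin (n + 1)) O) 0)))) := by
  -- adapted from res-type-051's `CILift.smooth_ciNose_of_flat` (p521509)
  have hφX : ∀ i : Fin (n + 1), φ (X i) = X i := fun i => by rw [hφ, map_X]
  have hφF : ∀ l, φ (Δt l) = Δ l := fun l => by rw [hφ, map_rowMinor_eq π Mt M hMtM Δt Δ hΔtdef hΔdef l]
  set Ck := projIdealSheaf (homogeneousSubmodule (Fin (n + 1)) k)
    ⟨Ideal.span (Set.range Δ), isHomogeneous_span_of_forall_mem _ Δ D hΔ⟩ with hCk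
  have h : EmbeddedLift.LiftsEmbedded φ hφ' Ck.subschemeι
      (projIdealSheaf (homogeneousSubmodule (Fin (n + 1)) O)
        ⟨Ideal.span (Set.range Δt), isHomogeneous_span_of_forall_mem _ Δt D hΔt⟩) := by
    refine ⟨hflat, ?_⟩
    rw [CILift.comap_projIdealSheaf_span φ hφ' hφX Δt Δ D hΔt hΔ hφF, Scheme.IdealSheafData.ker_subschemeι]
  have hS := smooth_subschemeι_projIdealSheaf_rowMinors M Δ hΔdef D hΔ hJ
  exact EmbeddedLift.LiftsEmbedded.smooth π hπ hφ h hS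

include hφ hMtM hΔtdef hΔdef hJ in
omit [IsDomain O] [IsDiscreteValuationRing O] in
/-- **hKEY for the determinantal nose: `I_t(M̃)~ · 𝒪_{ℙⁿ_k} = 𝓘_Σ`**, `Σ = {y | ∀ l, Δ_l ∈ 𝔮_y}` — res-D-pv-027's base change
`CILift.comap_projIdealSheaf_span` (p518108) followed by part 3's `projIdealSheaf_rowMinors_eq_vanishingIdeal`.
[cite: Hartshorne1977, II Prop. 5.9, Cor. 5.16] -/
theorem comap_projIdealSheaf_rowMinors_eq_vanishingIdeal
    (hSig : IsClosed {y : Proj (homogeneousSubmodule (Fin (n + 1)) k) |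
      ∀ l, Δ l ∈ (y : ProjectiveSpectrum (homogeneousSubmodule (Fin (n + 1)) k)).asHomogeneousIdeal}) :
    (projIdealSheaf (homogeneousSubmodule (Fin (n + 1)) O)
        ⟨Ideal.span (Set.range Δt), isHomogeneous_span_of_forall_mem _ Δt D hΔt⟩).comap (Proj.map φ hφ') =
      Scheme.IdealSheafData.vanishingIdeal
        ⟨{y : Proj (homogeneousSubmodule (Fin (n + 1)) k) |
          ∀ l, Δ l ∈ (y : ProjectiveSpectrum (homogeneousSubmodule (Fin (n + 1)) k)).asHomogeneousIdeal}, hSig⟩ := by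
  have hφX : ∀ i : Fin (n + 1), φ (X i) = X i := fun i => by rw [hφ, map_X]
  have hφF : ∀ l, φ (Δt l) = Δ l := fun l => by rw [hφ, map_rowMinor_eq π Mt M hMtM Δt Δ hΔtdef hΔdef l]
  rw [CILift.comap_projIdealSheaf_span φ hφ' hφX Δt Δ D hΔt hΔ hφF]
  exact projIdealSheaf_rowMinors_eq_vanishingIdeal M Δ hΔdef D hΔ hJ hSig

end Upstairs

/-! ## §2 The (LIFT)-form supplier for the smooth determinantal nose -/

/-- **T-DET-PROJ CAPSTONE — the (LIFT)-form supplier for the SMOOTH DETERMINANTAL NOSE.** `k` algebraically closed, `n : ℕ`. For every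
complete DVR `O` with algebraically closed residue field and surjection `π : O ↠ k`, every `t`, degree vectors `α : Fin (t+1) → ℕ`,
`β : Fin t → ℕ` and matrix `M` of forms on `ℙⁿ_k` with `M_{ab} ∈ 𝒜(α_a + β_b)`, whose determinantal locus
`Σ = {y | ∀ l, det(M minus row l) ∈ 𝔮_y}` satisfies the JACOBIAN-PAIR clause «∀ y ∈ Σ ∃ a b (e : Fin 2 ↪ Fin (n+1)),
det (Matrix.of fun r s => ∂_{x_{e s}} (![Δ_a, Δ_b] r)) ∉ 𝔮_y» (`Σ` SMOOTH OF CODIMENSION 2), and every closedness proof `hSig`: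
**there is an ideal sheaf `C` on `ℙⁿ_O` with `V(C) → Spec O` SMOOTH and `C.comap (Proj.map φ hφ') = vanishingIdeal ⟨Σ, hSig⟩` for every graded
`φ` over `π`** — namely `C = I_t(M̃)~` for an entrywise homogeneous lift `M̃` of `M`. Parts 1–3 + res-D-pv-027's P2/P4/T2b + res-type-051's
CI-JAC/T4 route, by name; Eagon–Northcott upstairs and downstairs; no Hilbert–Burch complex. Shape = `CILift.ciLift` / the (LIFT) hypothesis
of `stub_elnat_ciNoseThenPoints_of_suppliers` with `(c, f, d)` replaced by `(t, M, α, β)` and the Jacobian clause by the Jacobian-PAIR clause.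
[cite: Matsumura1987, Thm. 13.10, Thm. 14.2 and Thm. 30.4; Hartshorne1977, III Prop. 9.7; StacksProject, Tag 01V8] -/
theorem detLift (k : Type) [Field k] [IsAlgClosed k] (n : ℕ) :
    ∀ (O : Type) [CommRing O] [IsDomain O] [IsDiscreteValuationRing O] [IsAdicComplete (IsLocalRing.maximalIdeal O) O]
      [IsAlgClosed (IsLocalRing.ResidueField O)] (π : O →+* k), Function.Surjective π →
    ∀ (t : ℕ) (M : Matrix (Fin (t + 1)) (Fin t) (MvPolynomial (Fin (n + 1)) k)) (α : Fin (t + 1) → ℕ) (β : Fin t → ℕ),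
      (∀ a b, M a b ∈ MvPolynomial.homogeneousSubmodule (Fin (n + 1)) k (α a + β b)) →
      (∀ y : Proj (MvPolynomial.homogeneousSubmodule (Fin (n + 1)) k),
        (∀ l : Fin (t + 1), (M.submatrix l.succAbove id).det ∈
          (y : ProjectiveSpectrum (MvPolynomial.homogeneousSubmodule (Fin (n + 1)) k)).asHomogeneousIdeal) →
        ∃ (a b : Fin (t + 1)) (e : Fin 2 ↪ Fin (n + 1)),
          (Matrix.of fun r s => MvPolynomial.pderiv (e s)
            (![(M.submatrix a.succAbove id).det, (M.submatrix b.succAbove id).det] r)).det ∉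
            (y : ProjectiveSpectrum (MvPolynomial.homogeneousSubmodule (Fin (n + 1)) k)).asHomogeneousIdeal) →
      ∀ (hSig : IsClosed {y : Proj (MvPolynomial.homogeneousSubmodule (Fin (n + 1)) k) |
        ∀ l : Fin (t + 1), (M.submatrix l.succAbove id).det ∈
          (y : ProjectiveSpectrum (MvPolynomial.homogeneousSubmodule (Fin (n + 1)) k)).asHomogeneousIdeal}),
      ∃ C : (Proj (MvPolynomial.homogeneousSubmodule (Fin (n + 1)) O)).IdealSheafData,
        AlgebraicGeometry.Smooth (C.subschemeι ≫
          (Proj.toSpecZero (MvPolynomial.homogeneousSubmodule (Fin (n + 1)) O) ≫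
            Spec.map (CommRingCat.ofHom (algebraMap O ((MvPolynomial.homogeneousSubmodule (Fin (n + 1)) O) 0))))) ∧
        ∀ (φ : (MvPolynomial.homogeneousSubmodule (Fin (n + 1)) O) →+*ᵍ (MvPolynomial.homogeneousSubmodule (Fin (n + 1)) k))
          (hφ' : HomogeneousIdeal.irrelevant (MvPolynomial.homogeneousSubmodule (Fin (n + 1)) k) ≤
            (HomogeneousIdeal.irrelevant (MvPolynomial.homogeneousSubmodule (Fin (n + 1)) O)).map φ),
          (∀ s, φ s = MvPolynomial.map π s) →
          C.comap (Proj.map φ hφ') =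
            Scheme.IdealSheafData.vanishingIdeal
              ⟨{y : Proj (MvPolynomial.homogeneousSubmodule (Fin (n + 1)) k) |
                ∀ l : Fin (t + 1), (M.submatrix l.succAbove id).det ∈
                  (y : ProjectiveSpectrum (MvPolynomial.homogeneousSubmodule (Fin (n + 1)) k)).asHomogeneousIdeal}, hSig⟩ := by
  intro O _ _ _ _ _ π hπ t M α β hM hjac hSig
  haveI : PerfectField k := IsAlgClosed.perfectField k
  -- the uniformiser and `π ϖ = 0`
  obtain ⟨ϖ, hϖ⟩ := IsDiscreteValuationRing.exists_irreducible O
  have hπϖ : π ϖ = 0 := CILift.map_eq_zero_of_irreducible π hπ hϖ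
  -- the lift `M̃` (res-type-032's homogeneous Hilbert–Burch lift, p523558) and the NAMED minor families
  obtain ⟨Mt, hMtM, hMt, hΔthom, -⟩ :=
    exists_homogeneous_lift_rowMinors π hπ M α β fun a b => (mem_homogeneousSubmodule _ _).mp (hM a b)
  set D : Fin (t + 1) → ℕ := fun l => ∑ i, α (l.succAbove i) + ∑ j, β j with hDdef
  set Δ : Fin (t + 1) → MvPolynomial (Fin (n + 1)) k := fun l => (M.submatrix l.succAbove id).det with hΔdef'
  set Δt : Fin (t + 1) → MvPolynomial (Fin (n + 1)) O := fun l => (Mt.submatrix l.succAbove id).det with hΔtdef'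
  have hΔdef : ∀ l, Δ l = (M.submatrix l.succAbove id).det := fun l => rfl
  have hΔtdef : ∀ l, Δt l = (Mt.submatrix l.succAbove id).det := fun l => rfl
  have hΔ : ∀ l, Δ l ∈ homogeneousSubmodule (Fin (n + 1)) k (D l) := fun l =>
    det_submatrix_succAbove_mem_homogeneousSubmodule M hM l
  have hΔt : ∀ l, Δt l ∈ homogeneousSubmodule (Fin (n + 1)) O (D l) := fun l =>
    (mem_homogeneousSubmodule _ _).mpr (hΔthom l)
  -- (J) ⇒ (J′-pair) downstairs
  have hJ := pairDown_of_jacobianPair Δ D hΔ hjac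
  -- the nose `C := I_t(M̃)~`
  refine ⟨projIdealSheaf (homogeneousSubmodule (Fin (n + 1)) O)
    ⟨Ideal.span (Set.range Δt), isHomogeneous_span_of_forall_mem _ Δt D hΔt⟩, ?_, ?_⟩
  · -- a coefficient map `φ₀` over `π` to run T4 (the statement of T4 is `φ`-free)
    let φ₀ : (homogeneousSubmodule (Fin (n + 1)) O) →+*ᵍ (homogeneousSubmodule (Fin (n + 1)) k) :=
      ⟨MvPolynomial.map π, fun h => h.map π⟩
    have hφ₀ : ∀ s, φ₀ s = MvPolynomial.map π s := fun _ => rfl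
    have hφ₀' := ProjectiveAmbientFibre.irrelevant_le_map_gradedMap π φ₀ hφ₀
    have hrf := isRegular_and_flat_detNose O ϖ hϖ π hπ hπϖ φ₀ hφ₀' hφ₀ Mt M hMtM Δt Δ hΔtdef hΔdef D hΔt hΔ hJ
    exact smooth_detNose_of_flat π hπ φ₀ hφ₀' hφ₀ Mt M hMtM Δt Δ hΔtdef hΔdef D hΔt hΔ hJ hrf.2
  · intro φ hφ' hφ
    exact comap_projIdealSheaf_rowMinors_eq_vanishingIdeal π φ hφ' hφ Mt M hMtM Δt Δ hΔtdef hΔdef D hΔt hΔ hJ hSig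

end DetLift

end Summit.ResolutionOfSingularities.ResolutionOfSingularities.Cruxes.EquisingularLiftNat.Sections

end
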